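import Literature.AlgebraicGeometry.Resolution.InseparableLocalUniformizationDecompletion
import Literature.AlgebraicGeometry.Resolution.InseparableLocalUniformizationAlgebra
import Literature.AlgebraicGeometry.Resolution.NormalizationOfVarietiesProofs
import Literature.AlgebraicGeometry.Resolution.DecompletionChartCore
import Literature.AlgebraicGeometry.Resolution.ValuedFunctionFieldsLemmas
import Literature.AlgebraicGeometry.Resolution.DecompletionValuative
import Mathlib.RingTheory.Jacobson.Ring
import HarnessLib

/-!
# Temkin's decompletion lemma, algebraic proof — II. Setup: the chart adapted to the valuation

Topic: `Literature/AlgebraicGeometry/Resolution`. M. Temkin, *Inseparable local uniformization*,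
J. Algebra 373 (2013) 65–119 = arXiv:0804.1554v3, Lemma 3.3.2 (tree: the corrected rendering
`Temkin2013_Lemma332_nft`, `InseparableLocalUniformizationDecompletion.lean`). This file fixes,
once and for all, the DATA on which the algebraic proof of the lemma operates, and proves that
the hypotheses of `Temkin2013_Lemma332_nft` produce such data:

* `baseRing K V` — the image `k° ⊆ K`.
* `exists_pow_mul_mem_closure`, `adjoin_closure_eq`, `exists_adapted_generators` — unpacking an
  affine normalized model `A = Nr_K(k°[s])` with `Frac A = K` and `K/k` finitely generated over a
  HEIGHT-ONE `k°`: there are finitely many `f ⊆ A` with `A = Nr_K(k°[f])`, `k[A] = k[f]` and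
  `πᴺ r ∈ k°[f]` for every `r ∈ k[A]` (E. Noether's finiteness of the normalization of `k[f]`,
  `NoetherFiniteIntegralClosure_holds`; "Multiplying `f` and `π` by a large power of `π` we
  achieve that `f ⊂ 𝒜° = Â`", Temkin p. 46) — PROVED.
* `DecompChart V O A φ` — the structure recording: `π`; the generators `f`; the chart
  `h ∈ k[A]` with `φ(h) = 1`, `Rh = k[A][1/h] ⊆ K` (the tree's `locAway`), the point `φh : Rh → m`,
  étale coordinates `T₁, …, T_n ∈ Rh` vanishing at the point and a standard étale presentation
  `P` of `Rh` over `k[X₁, …, X_n]` (`Xᵢ ↦ Tᵢ`); and the standing hypotheses (`m/k` finite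
  separable, `O ∩ k = k°`, `φ(A) ⊆ O`).
* `exists_decompChart` — EXISTENCE of a `DecompChart` under the hypotheses of
  `Temkin2013_Lemma332_nft` (`exists_adapted_generators` + `exists_chart_core` of
  `DecompletionChartCore.lean` + Zariski's lemma for `[m : k] < ∞`) — PROVED.

All statements are [folklore] glue around the cited inputs; no named facts.

## Sources

* M. Temkin, arXiv:0804.1554v3, Lemma 3.3.2 and its proof (pp. 45–46); §3.3 (p. 44:
  affine normalized models).
-/

noncomputable section

open Polynomial

namespace Literature.AlgebraicGeometry.Resolution

universe u

variable {k K m : Type u} [Field k] [Field K] [Algebra k K] [Field m] [Algebra k m]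

variable (K) in
/-- The image `k° ⊆ K` of the valuation ring of the base field. [folklore] -/
abbrev baseRing (V : ValuationSubring k) : Subring K :=
  V.toSubring.map (algebraMap k K)

/-! ### Unpacking an affine normalized model: generators adapted to `k[A]` -/

section Unpack

variable (V : ValuationSubring k) (hdim : ringKrullDim V = 1) {π : k} (hπV : π ∈ V)
  (hπlt : V.valuation π < 1)

/-- `k°`-constants lie in `k°[anything]`. [folklore] -/
theorem algebraMap_mem_closure_of_mem {t : Set K} {c : k} (hc : c ∈ V) :
    algebraMap k K c ∈ Subring.closure ((baseRing K V : Set K) ∪ t) :=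
  Subring.subset_closure (Set.mem_union_left _ ⟨c, hc, rfl⟩)

include hdim hπV hπlt in
/-- **`π`-bounded denominators**: every element of `k[t]` lies in `k°[t]` after multiplication
by a power of `π` (`k = k°[1/π]` in height one). [folklore] -/
theorem exists_pow_mul_mem_closure (t : Set K) {r : K} (hr : r ∈ Algebra.adjoin k t) :
    ∃ N : ℕ, algebraMap k K π ^ N * r ∈ Subring.closure ((baseRing K V : Set K) ∪ t) := by
  induction hr using Algebra.adjoin_induction with
  | mem z hz => exact ⟨0, by simpa using Subring.subset_closure (Set.mem_union_right _ hz)⟩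
  | algebraMap c =>
    obtain ⟨N, hN⟩ := exists_pow_mul_mem_of_ringKrullDim_eq_one V hdim hπV hπlt c
    refine ⟨N, ?_⟩
    rw [← map_pow, ← map_mul]
    exact algebraMap_mem_closure_of_mem V hN
  | add z w _ _ hz hw =>
    obtain ⟨N, hN⟩ := hz
    obtain ⟨M, hM⟩ := hw
    refine ⟨N + M, ?_⟩
    have : algebraMap k K π ^ (N + M) * (z + w) =
        algebraMap k K π ^ M * (algebraMap k K π ^ N * z) +
          algebraMap k K π ^ N * (algebraMap k K π ^ M * w) := by rw [pow_add]; ring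
    rw [this]
    have hπ' : algebraMap k K π ∈ Subring.closure ((baseRing K V : Set K) ∪ t) :=
      algebraMap_mem_closure_of_mem V hπV
    exact Subring.add_mem _ (Subring.mul_mem _ (Subring.pow_mem _ hπ' _) hN)
      (Subring.mul_mem _ (Subring.pow_mem _ hπ' _) hM)
  | mul z w _ _ hz hw =>
    obtain ⟨N, hN⟩ := hz
    obtain ⟨M, hM⟩ := hw
    refine ⟨N + M, ?_⟩
    have : algebraMap k K π ^ (N + M) * (z * w) =
        (algebraMap k K π ^ N * z) * (algebraMap k K π ^ M * w) := by rw [pow_add]; ring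
    rw [this]
    exact Subring.mul_mem _ hN hM

/-- `k[k°[t]] = k[t]`: adjoining a `k°`-subalgebra closure to `k` is adjoining its generators.
[folklore] -/
theorem adjoin_closure_eq (t : Set K) :
    Algebra.adjoin k (Subring.closure ((baseRing K V : Set K) ∪ t) : Set K) =
      Algebra.adjoin k t := by
  refine le_antisymm (Algebra.adjoin_le ?_) (Algebra.adjoin_mono ?_)
  · intro z hz
    induction hz using Subring.closure_induction with
    | mem z hz =>
      rcases hz with ⟨c, -, rfl⟩ | hz
      · exact Subalgebra.algebraMap_mem _ c
      · exact Algebra.subset_adjoin hz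
    | zero => exact Subalgebra.zero_mem _
    | one => exact Subalgebra.one_mem _
    | add _ _ _ _ hz hw => exact Subalgebra.add_mem _ hz hw
    | neg _ _ hz => exact Subalgebra.neg_mem _ hz
    | mul _ _ _ _ hz hw => exact Subalgebra.mul_mem _ hz hw
  · exact fun z hz => Subring.subset_closure (Set.mem_union_right _ hz)

include hdim hπV hπlt in
/-- **Generators adapted to the generic fibre.** For an affine normalized model `A ⊆ K` of
`K°` over a height-one `k°` with `K/k` finitely generated, there is a finite `f ⊆ A` with
`A = Nr_K(k°[f])`, `k[A] = k[f]` (E. Noether's finiteness of the normalization of the finitely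
generated domain `k[f]`, `NoetherFiniteIntegralClosure_holds`), and `πᴺ r ∈ k°[f]` for every
`r ∈ k[A]`. [folklore] -/
theorem exists_adapted_generators (hπ0 : π ≠ 0) (A : Subring K)
    (hA : IsAffineNormalizedModel ⊤ (baseRing K V) A) (hFG : (⊤ : IntermediateField k K).FG) :
    ∃ f : Finset K, (↑f : Set K) ⊆ A ∧
      (∀ z : K, z ∈ A ↔ IsIntegral (Subring.closure ((baseRing K V : Set K) ∪ ↑f)) z) ∧
      Algebra.adjoin k (A : Set K) = Algebra.adjoin k (↑f : Set K) ∧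
      ∀ r ∈ Algebra.adjoin k (A : Set K), ∃ N : ℕ,
        algebraMap k K π ^ N * r ∈ Subring.closure ((baseRing K V : Set K) ∪ ↑f) := by
  classical
  obtain ⟨s, -, hAs, hfrac⟩ := hA
  set C₀ := Subring.closure ((baseRing K V : Set K) ∪ ↑s) with hC₀
  -- `A = Nr_K(C₀)` and `A` is integrally closed in `K`
  have hAC₀ : A = nrIn C₀ := SetLike.coe_injective (by rw [hAs]; rfl)
  have hAcl : ∀ z : K, IsIntegral A z → z ∈ A := fun z hz => by
    have : z ∈ nrIn A := hz
    rwa [hAC₀, nrIn_nrIn, ← hAC₀] at this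
  have hsA : (↑s : Set K) ⊆ A := fun z hz => by
    rw [hAC₀]; exact le_nrIn C₀ (Subring.subset_closure (Set.mem_union_right _ hz))
  have hVA : (baseRing K V : Set K) ⊆ A := fun z hz => by
    rw [hAC₀]; exact le_nrIn C₀ (Subring.subset_closure (Set.mem_union_left _ hz))
  -- `π`-denominators for `k[A]`
  have hdenA : ∀ r ∈ Algebra.adjoin k (A : Set K), ∃ N : ℕ, algebraMap k K π ^ N * r ∈ A := by
    intro r hr
    obtain ⟨N, hN⟩ := exists_pow_mul_mem_closure V hdim hπV hπlt (A : Set K) hr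
    refine ⟨N, ?_⟩
    have hle : Subring.closure ((baseRing K V : Set K) ∪ (A : Set K)) ≤ A :=
      Subring.closure_le.mpr (Set.union_subset hVA subset_rfl)
    exact hle hN
  -- generators of `K/k`, written as fractions from `A`
  obtain ⟨g, hg⟩ := hFG
  choose num hnum den hden heq using hfrac
  let s₁ : Finset K := s ∪ g.image num ∪ g.image den
  have hmem_s : ∀ z ∈ s, z ∈ s₁ := fun z hz =>
    Finset.mem_union_left _ (Finset.mem_union_left _ hz)
  have hmem_num : ∀ w ∈ g, num w ∈ s₁ := fun w hw =>
    Finset.mem_union_left _ (Finset.mem_union_right _ (Finset.mem_image_of_mem num hw))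
  have hmem_den : ∀ w ∈ g, den w ∈ s₁ := fun w hw =>
    Finset.mem_union_right _ (Finset.mem_image_of_mem den hw)
  have hs₁A : (↑s₁ : Set K) ⊆ A := by
    intro z hz
    rcases Finset.mem_union.mp (Finset.mem_coe.mp hz) with hz | hz
    · rcases Finset.mem_union.mp hz with hz | hz
      · exact hsA (Finset.mem_coe.mpr hz)
      · obtain ⟨w, -, rfl⟩ := Finset.mem_image.mp hz
        exact hnum w
    · obtain ⟨w, -, rfl⟩ := Finset.mem_image.mp hz
      exact hden w
  -- `R₁ = k[s₁]`, a finitely generated domain with fraction field `K`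
  let R₁ : Subalgebra k K := Algebra.adjoin k (↑s₁ : Set K)
  haveI : Algebra.FiniteType k R₁ := (Subalgebra.fg_iff_finiteType _).mp ⟨s₁, rfl⟩
  haveI : IsFractionRing R₁ K := by
    refine IsFractionRing.of_field R₁ K fun z => ?_
    -- `z ∈ ⊤ = k(g)` and each `g = num g / den g` with `num, den ∈ R₁`
    have hzg : z ∈ IntermediateField.adjoin k (R₁ : Set K) := by
      have htop : IntermediateField.adjoin k (↑g : Set K) ≤ IntermediateField.adjoin k (R₁ : Set K) := by
        refine IntermediateField.adjoin_le_iff.mpr fun w hw => ?_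
        rw [heq w]
        refine div_mem (IntermediateField.subset_adjoin _ _ ?_) (IntermediateField.subset_adjoin _ _ ?_)
        · exact Algebra.subset_adjoin (Finset.mem_coe.mpr (hmem_num w hw))
        · exact Algebra.subset_adjoin (Finset.mem_coe.mpr (hmem_den w hw))
      have : z ∈ (⊤ : IntermediateField k K) := IntermediateField.mem_top
      rw [← hg] at this
      exact htop this
    rw [IntermediateField.mem_adjoin_iff_div] at hzg
    obtain ⟨a, ha, b, hb, rfl⟩ := hzg
    rw [Algebra.adjoin_eq] at ha hb
    exact ⟨⟨a, ha⟩, ⟨b, hb⟩, rfl⟩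
  -- E. Noether: the normalization of `R₁` is finite
  haveI hfin : Module.Finite R₁ (integralClosure R₁ K) := NoetherFiniteIntegralClosure_holds k R₁ K K
  -- `k[A]` is (as a set) the integral closure of `R₁` in `K`
  have hC₁ : Subring.closure ((baseRing K V : Set K) ∪ ↑s₁) ≤ A :=
    Subring.closure_le.mpr (Set.union_subset hVA hs₁A)
  have hR₁sub : ∀ z : K, IsIntegral R₁ z → z ∈ Algebra.adjoin k (A : Set K) := by
    intro z hz
    -- integral closure commutes with the localization `k[C₁] = C₁[1/(V∖0)]`
    have hR₁eq : R₁ = Algebra.adjoin k (Subring.closure ((baseRing K V : Set K) ∪ ↑s₁) : Set K) :=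
      (adjoin_closure_eq V _).symm
    have hz' : IsIntegral (Algebra.adjoin k
        (Subring.closure ((baseRing K V : Set K) ∪ ↑s₁) : Set K)) z := by
      rw [← hR₁eq]; exact hz
    have hB : ∀ c : k, ∃ a ∈ V.toSubring, ∃ b ∈ V.toSubring, c = a / b := fun c => by
      rcases V.mem_or_inv_mem c with hc | hc
      · exact ⟨c, hc, 1, V.one_mem, by simp⟩
      · by_cases hc0 : c = 0
        · exact ⟨0, V.zero_mem, 1, V.one_mem, by simp [hc0]⟩
        · exact ⟨1, V.one_mem, c⁻¹, hc, by field_simp⟩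
    obtain ⟨b, hbV, hb0, hbz⟩ := exists_mul_isIntegral_of_isIntegral_adjoin V.toSubring hB
      (Subring.closure ((baseRing K V : Set K) ∪ ↑s₁))
      (fun _ ⟨c, hc, e⟩ => e ▸ Subring.subset_closure (Set.mem_union_left _ ⟨c, hc, rfl⟩)) hz'
    -- `b z ∈ A`
    have hbzA : algebraMap k K b * z ∈ A := by
      apply hAcl
      letI : Algebra (Subring.closure ((baseRing K V : Set K) ∪ ↑s₁)) A :=
        (Subring.inclusion hC₁).toAlgebra
      haveI : IsScalarTower (Subring.closure ((baseRing K V : Set K) ∪ ↑s₁)) A K :=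
        IsScalarTower.of_algebraMap_eq (fun _ => rfl)
      exact hbz.tower_top
    have : z = (algebraMap k K b)⁻¹ * (algebraMap k K b * z) := by
      rw [← mul_assoc, inv_mul_cancel₀ ((_root_.map_ne_zero _).mpr hb0), one_mul]
    rw [this, ← map_inv₀]
    exact Subalgebra.mul_mem _ (Subalgebra.algebraMap_mem _ _) (Algebra.subset_adjoin hbzA)
  have hsubR₁ : ∀ z ∈ Algebra.adjoin k (A : Set K), IsIntegral R₁ z := by
    intro z hz
    refine Algebra.adjoin_le (S := (integralClosure R₁ K).restrictScalars k) ?_ hz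
    intro a ha
    change IsIntegral R₁ a
    -- `a` is integral over `C₀ ⊆ R₁`
    have haC₀ : IsIntegral C₀ a := by rw [hAC₀] at ha; exact ha
    have hC₀R₁ : C₀ ≤ R₁.toSubring := by
      refine Subring.closure_le.mpr (Set.union_subset ?_ ?_)
      · rintro _ ⟨c, -, rfl⟩; exact Subalgebra.algebraMap_mem _ c
      · intro z hz
        exact Algebra.subset_adjoin (Finset.mem_coe.mpr (hmem_s z (Finset.mem_coe.mp hz)))
    letI : Algebra C₀ R₁ := (Subring.inclusion hC₀R₁).toAlgebra
    haveI : IsScalarTower C₀ R₁ K := IsScalarTower.of_algebraMap_eq (fun _ => rfl)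
    exact haC₀.tower_top
  -- generators: `s₁` and a spanning set of the normalization, scaled into `A`
  obtain ⟨w, hw⟩ := Module.finite_def.mp hfin
  -- scale each `w` into `A`
  have hwR : ∀ z : integralClosure R₁ K, (z : K) ∈ Algebra.adjoin k (A : Set K) := fun z =>
    hR₁sub z z.2
  choose Nw hNw using fun z : integralClosure R₁ K => hdenA z (hwR z)
  let f : Finset K := s₁ ∪ w.image fun z => algebraMap k K π ^ Nw z * (z : K)
  have hmem_s₁ : ∀ z ∈ s₁, z ∈ f := fun z hz => Finset.mem_union_left _ hz
  have hmem_w : ∀ z ∈ w, algebraMap k K π ^ Nw z * (z : K) ∈ f := fun z hz =>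
    Finset.mem_union_right _ (Finset.mem_image_of_mem _ hz)
  have hfA : (↑f : Set K) ⊆ A := by
    intro z hz
    rcases Finset.mem_union.mp (Finset.mem_coe.mp hz) with hz | hz
    · exact hs₁A (Finset.mem_coe.mpr hz)
    · obtain ⟨z, -, rfl⟩ := Finset.mem_image.mp hz
      exact hNw z
  have hAint : ∀ z : K, z ∈ A ↔ IsIntegral (Subring.closure ((baseRing K V : Set K) ∪ ↑f)) z := by
    intro z
    have hle₁ : C₀ ≤ Subring.closure ((baseRing K V : Set K) ∪ ↑f) :=
      Subring.closure_mono (Set.union_subset_union_right _ (fun z hz =>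
        Finset.mem_coe.mpr (hmem_s₁ z (hmem_s z (Finset.mem_coe.mp hz)))))
    have hle₂ : Subring.closure ((baseRing K V : Set K) ∪ ↑f) ≤ A :=
      Subring.closure_le.mpr (Set.union_subset hVA hfA)
    constructor
    · intro hz
      rw [hAC₀] at hz
      exact nrIn_mono hle₁ hz
    · intro hz
      have : z ∈ nrIn A := nrIn_mono hle₂ hz
      rwa [hAC₀, nrIn_nrIn, ← hAC₀] at this
  have hRf : Algebra.adjoin k (A : Set K) = Algebra.adjoin k (↑f : Set K) := by
    refine le_antisymm ?_ (Algebra.adjoin_mono hfA)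
    -- `k[A] ⊆ Nr(R₁) = span of w over R₁ ⊆ k[f]`
    intro z hz
    have hzN : (⟨z, hsubR₁ z hz⟩ : integralClosure R₁ K) ∈ Submodule.span R₁ (w : Set _) := by
      rw [hw]; exact Submodule.mem_top
    have key : ∀ y : integralClosure R₁ K, y ∈ Submodule.span R₁ (w : Set _) →
        (y : K) ∈ Algebra.adjoin k (↑f : Set K) := by
      intro y hy
      induction hy using Submodule.span_induction with
      | mem y hy =>
        have hπK : algebraMap k K π ≠ 0 := (_root_.map_ne_zero _).mpr hπ0
        have : (y : K) = (algebraMap k K π ^ Nw y)⁻¹ * (algebraMap k K π ^ Nw y * (y : K)) := by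
          rw [← mul_assoc, inv_mul_cancel₀ (pow_ne_zero _ hπK), one_mul]
        rw [this, ← map_pow, ← map_inv₀]
        refine Subalgebra.mul_mem _ (Subalgebra.algebraMap_mem _ _) (Algebra.subset_adjoin ?_)
        rw [map_pow]
        exact Finset.mem_coe.mpr (hmem_w y hy)
      | zero => exact Subalgebra.zero_mem _
      | add y y' _ _ hy hy' => exact Subalgebra.add_mem _ hy hy'
      | smul r y _ hy =>
        change ((r : K) * (y : K)) ∈ _
        refine Subalgebra.mul_mem _ ?_ hy
        exact Algebra.adjoin_mono (fun z hz => Finset.mem_coe.mpr (hmem_s₁ z (Finset.mem_coe.mp hz))) r.2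
    exact key _ hzN
  refine ⟨f, hfA, hAint, hRf, fun r hr => ?_⟩
  rw [hRf] at hr
  exact exists_pow_mul_mem_closure V hdim hπV hπlt _ hr

end Unpack

/-! ### The chart structure -/

/-- **Étale chart of the generic fibre at the point, adapted to the valuation** — the data on
which the algebraic proof of Temkin 2013, Lemma 3.3.2 runs (the finite-level substitute for "a
system of regular parameters `T` of `𝒪_{𝔛_η,x̂}` … étale at `x̂`", p. 45), for a height-one
valuation ring `V = k°`, a valuation ring `O = m°` of `m`, an affine normalized model `A ⊆ K`
and a closed point `φ : k[A] → m` of the generic fibre. Fields: a pseudo-uniformizer `π`; the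
standing hypotheses; generators `f` with `A = Nr_K(k°[f])`, `k[A] = k[f]` and `π`-bounded
denominators; a denominator `h ∈ k[A]` with `φ(h) = 1` (so that `h` stays a unit near the
centre of `m°`); the point `φh` on `Rh = k[A][1/h] ⊆ K`; étale coordinates `T : Fin n → Rh`
VANISHING at the point; a standard étale presentation `P` of `Rh` over `k[X₁, …, X_n]`,
`Xᵢ ↦ Tᵢ`. [folklore] -/
structure DecompChart (V : ValuationSubring k) (O : ValuationSubring m) (A : Subring K)
    (φ : Algebra.adjoin k (A : Set K) →ₐ[k] m) where
  /-- height one -/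
  hdim : ringKrullDim V = 1
  /-- the pseudo-uniformizer `π ∈ k°°`, non-zero -/
  π : k
  hπV : π ∈ V
  hπlt : V.valuation π < 1
  hπ0 : π ≠ 0
  /-- `O ∩ k = k°` -/
  hOV : O.comap (algebraMap k m) = V
  /-- `m/k` is finite separable -/
  hfin : FiniteDimensional k m
  hsepm : Algebra.IsSeparable k m
  /-- the point: `φ` surjective, `φ(A) ⊆ O` -/
  hφsurj : Function.Surjective φ
  hφA : ∀ a : A, φ ⟨a, Algebra.subset_adjoin a.2⟩ ∈ O
  /-- generators of the model -/
  f : Finset K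
  hfA : (↑f : Set K) ⊆ A
  /-- `A = Nr_K(k°[f])` -/
  hAint : ∀ z : K, z ∈ A ↔ IsIntegral (Subring.closure ((baseRing K V : Set K) ∪ ↑f)) z
  /-- `Frac A = K` -/
  hfrac : ∀ z : K, ∃ a ∈ A, ∃ b ∈ A, z = a / b
  /-- `k[A] = k[f]` -/
  hRf : Algebra.adjoin k (A : Set K) = Algebra.adjoin k (↑f : Set K)
  /-- `π`-bounded denominators: `k[A] = k°[f][1/π]` -/
  hden : ∀ r ∈ Algebra.adjoin k (A : Set K), ∃ N : ℕ,
    algebraMap k K π ^ N * r ∈ Subring.closure ((baseRing K V : Set K) ∪ ↑f)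
  /-- the denominator of the chart, with `φ(h) = 1` -/
  h : K
  hhR : h ∈ Algebra.adjoin k (A : Set K)
  hφh : φ ⟨h, hhR⟩ = 1
  hh0 : h ≠ 0
  /-- the point on the chart `Rh = k[A][1/h]` -/
  φh : locAway (Algebra.adjoin k (A : Set K)) h hhR →ₐ[k] m
  hφhφ : ∀ (r : Algebra.adjoin k (A : Set K))
    (hr : (r : K) ∈ locAway (Algebra.adjoin k (A : Set K)) h hhR), φh ⟨r, hr⟩ = φ r
  /-- étale coordinates vanishing at the point -/
  n : ℕ
  T : Fin n → K
  hTRh : ∀ i, T i ∈ locAway (Algebra.adjoin k (A : Set K)) h hhR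
  hφT : ∀ i, φh ⟨T i, hTRh i⟩ = 0
  /-- the standard étale presentation of `Rh` over `k[X₁, …, X_n]`, `Xᵢ ↦ Tᵢ` -/
  P : letI := (MvPolynomial.aeval (R := k)
      (fun i => (⟨T i, hTRh i⟩ : locAway (Algebra.adjoin k (A : Set K)) h hhR))).toAlgebra
    StandardEtalePresentation (MvPolynomial (Fin n) k)
      (locAway (Algebra.adjoin k (A : Set K)) h hhR)

namespace DecompChart

variable {V : ValuationSubring k} {O : ValuationSubring m} {A : Subring K}
  {φ : Algebra.adjoin k (A : Set K) →ₐ[k] m} (C : DecompChart V O A φ)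

/-- The generic fibre `R = k[A]`. [folklore] -/
abbrev R : Subalgebra k K := Algebra.adjoin k (A : Set K)

/-- The chart ring `Rh = k[A][1/h] ⊆ K`. [folklore] -/
abbrev Rh : Subalgebra k K := locAway (Algebra.adjoin k (A : Set K)) C.h C.hhR

/-- Membership in `Rh`: `z ∈ Rh ↔ hᴺ z ∈ k[A]`. [folklore] -/
theorem mem_Rh_iff (z : K) : z ∈ C.Rh ↔ ∃ N : ℕ, C.h ^ N * z ∈ Algebra.adjoin k (A : Set K) := by
  rw [mem_locAway_iff]
  simp only [mul_comm z]

/-- `Rh` as an `R`-algebra, by the inclusion `R = k[A] ≤ Rh = k[A][1/h]` (the structure used by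
`isLocalization_locAway`). [folklore] -/
instance algebra_Rh : Algebra (Algebra.adjoin k (A : Set K)) C.Rh :=
  (Subalgebra.inclusion (le_locAway (B := Algebra.adjoin k (A : Set K)) (f := C.h)
    (hf := C.hhR))).toRingHom.toAlgebra

/-- `k → R → Rh` is a tower. [folklore] -/
instance isScalarTower_Rh : IsScalarTower k (Algebra.adjoin k (A : Set K)) C.Rh :=
  IsScalarTower.of_algebraMap_eq fun _ => rfl

/-- `R → Rh → K` is a tower. [folklore] -/
instance isScalarTower_Rh' : IsScalarTower (Algebra.adjoin k (A : Set K)) C.Rh K :=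
  IsScalarTower.of_algebraMap_eq fun _ => rfl

/-- The coordinate algebra structure `k[X₁, …, X_n] → Rh`, `Xᵢ ↦ Tᵢ`. [folklore] -/
instance algB : Algebra (MvPolynomial (Fin C.n) k) C.Rh :=
  (MvPolynomial.aeval (R := k) (fun i => (⟨C.T i, C.hTRh i⟩ : C.Rh))).toAlgebra

/-- The coordinate structure is a tower over `k`. [folklore] -/
instance isScalarTower_algB : IsScalarTower k (MvPolynomial (Fin C.n) k) C.Rh :=
  IsScalarTower.of_algebraMap_eq fun c => by
    change algebraMap k C.Rh c = MvPolynomial.aeval _ (algebraMap k (MvPolynomial (Fin C.n) k) c)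
    rw [AlgHom.commutes]

/-- `Xᵢ ↦ Tᵢ`. [folklore] -/
theorem algebraMap_X (i : Fin C.n) :
    algebraMap (MvPolynomial (Fin C.n) k) C.Rh (MvPolynomial.X i) = ⟨C.T i, C.hTRh i⟩ :=
  MvPolynomial.aeval_X _ i

/-- `Xᵢ ↦ Tᵢ`, in `K`. [folklore] -/
@[simp] theorem algebraMap_X_coe (i : Fin C.n) :
    (algebraMap (MvPolynomial (Fin C.n) k) C.Rh (MvPolynomial.X i) : K) = C.T i := by
  rw [algebraMap_X]

/-- The structure map on a general polynomial is `k`-algebra evaluation at `T`. [folklore] -/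
theorem algebraMap_eq_aeval (q : MvPolynomial (Fin C.n) k) :
    algebraMap (MvPolynomial (Fin C.n) k) C.Rh q =
      MvPolynomial.aeval (R := k) (fun i => (⟨C.T i, C.hTRh i⟩ : C.Rh)) q := rfl

/-- `Rh` is standard étale over `k[X₁, …, X_n]`. [folklore] -/
instance isStandardEtale : Algebra.IsStandardEtale (MvPolynomial (Fin C.n) k) C.Rh := ⟨⟨C.P⟩⟩

/-- `Rh` is the localization of `k[A]` away from `h`. [folklore] -/
instance isLocalization_Rh :
    IsLocalization.Away (⟨C.h, C.hhR⟩ : Algebra.adjoin k (A : Set K)) C.Rh :=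
  isLocalization_locAway (B := Algebra.adjoin k (A : Set K)) (f := C.h) (hf := C.hhR) C.hh0

/-- `π` is non-zero in `K`. [folklore] -/
theorem algebraMap_π_ne_zero : algebraMap k K C.π ≠ 0 := (_root_.map_ne_zero _).mpr C.hπ0

include C in
/-- `k[A]` is of finite type over `k`. [folklore] -/
theorem finiteType_R : Algebra.FiniteType k (Algebra.adjoin k (A : Set K)) :=
  (Subalgebra.fg_iff_finiteType _).mp ⟨C.f, C.hRf.symm⟩

end DecompChart

/-! ### Existence of the chart -/

/-- **Existence of the chart** under the hypotheses of `Temkin2013_Lemma332_nft`: a height-one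
`k°` (with `O ∩ k = k°`), an affine normalized model `A` of `K°` with `K/k` finitely generated, a
closed point `φ : k[A] → m` of the generic fibre with `m/k` separable at which `k[A]` is smooth,
and `φ(A) ⊆ m°`. PROVED from `exists_adapted_generators`, Zariski's lemma
(`finite_of_finite_type_of_isJacobsonRing`) and `exists_chart_core`. [folklore] -/
theorem exists_decompChart (V : ValuationSubring k) (hdim : ringKrullDim V = 1) (A : Subring K)
    (hA : IsAffineNormalizedModel ⊤ (baseRing K V) A) (hFG : (⊤ : IntermediateField k K).FG)
    (φ : Algebra.adjoin k (A : Set K) →ₐ[k] m) (hφ : Function.Surjective φ)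
    (x : Ideal (Algebra.adjoin k (A : Set K))) [x.IsPrime]
    (hker : RingHom.ker (φ : Algebra.adjoin k (A : Set K) →+* m) = x)
    (hsm : Algebra.IsSmoothAt k x) [Algebra.IsSeparable k m] (O : ValuationSubring m)
    (hO : O.comap (algebraMap k m) = V) (hi : ∀ a : A, φ ⟨a, Algebra.subset_adjoin a.2⟩ ∈ O) :
    Nonempty (DecompChart V O A φ) := by
  classical
  -- a pseudo-uniformizer
  have hnf : ¬ IsField V := ((ringKrullDim_eq_one_iff_of_isLocalRing_isDomain).mp hdim).1
  obtain ⟨π₀, hπ₀m, hπ₀0⟩ : ∃ π₀ : V, π₀ ∈ IsLocalRing.maximalIdeal V ∧ π₀ ≠ 0 := by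
    by_contra hcon
    push Not at hcon
    apply hnf
    refine IsLocalRing.isField_iff_maximalIdeal_eq.mpr (le_bot_iff.mp fun z hz => ?_)
    exact hcon z hz
  let π : k := π₀
  have hπV : π ∈ V := π₀.2
  have hπlt : V.valuation π < 1 := (V.valuation_lt_one_iff π₀).mp hπ₀m
  have hπ0 : π ≠ 0 := fun h0 => hπ₀0 (Subtype.ext h0)
  -- generators
  obtain ⟨f, hfA, hAint, hRf, hden⟩ := exists_adapted_generators V hdim hπV hπlt hπ0 A hA hFG
  obtain ⟨-, -, -, hfrac⟩ := hA
  -- finiteness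
  haveI : Algebra.FiniteType k (Algebra.adjoin k (A : Set K)) :=
    (Subalgebra.fg_iff_finiteType _).mp ⟨f, hRf.symm⟩
  haveI : Algebra.FiniteType k m := Algebra.FiniteType.of_surjective φ hφ
  haveI hfin : FiniteDimensional k m := finite_of_finite_type_of_isJacobsonRing k m
  -- the chart
  obtain ⟨h, hhR, hφh, φh, hφhφ, n, T, hT, hφT, hstd⟩ :=
    exists_chart_core (Algebra.adjoin k (A : Set K)) φ hφ x hker hsm
  have hh0 : h ≠ 0 := by
    rintro rfl
    have : φ ⟨0, hhR⟩ = 0 := by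
      have : (⟨(0 : K), hhR⟩ : Algebra.adjoin k (A : Set K)) = 0 := rfl
      rw [this, map_zero]
    rw [this] at hφh
    exact zero_ne_one hφh
  letI := (MvPolynomial.aeval (R := k)
    (fun i => (⟨T i, hT i⟩ : locAway (Algebra.adjoin k (A : Set K)) h hhR))).toAlgebra
  haveI := hstd
  exact ⟨{
    hdim := hdim, π := π, hπV := hπV, hπlt := hπlt, hπ0 := hπ0, hOV := hO, hfin := hfin,
    hsepm := inferInstance, hφsurj := hφ, hφA := hi, f := f, hfA := hfA, hAint := hAint,
    hfrac := hfrac, hRf := hRf, hden := hden, h := h, hhR := hhR, hφh := hφh, hh0 := hh0,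
    φh := φh, hφhφ := hφhφ, n := n, T := T, hTRh := hT, hφT := hφT,
    P := (Algebra.IsStandardEtale.nonempty_standardEtalePresentation
      (R := MvPolynomial (Fin n) k)
      (S := locAway (Algebra.adjoin k (A : Set K)) h hhR)).some }⟩

end Literature.AlgebraicGeometry.Resolution
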